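import Summits.RiemannHypothesis.RiemannHypothesis.Theorems.SoloInformedRigidityProbe
import Literature.NumberTheory.LFunctions.WeilArchimedeanPositivityProofs
import Literature.NumberTheory.LFunctions.WeilLineZerosDensity
import HarnessLib

/-!
# Pair-correlation rigidity, step R2c': the polar term of the probe (T72g-polar, soloist)

Sorry-free.  For the probe `f = f_{b,t}` (`SoloInformedRigidityProbe`) and `k = f ⋆ f̃` the polar
term of the explicit formula is `2 Re (f̂(0) conj f̂(1))` and `f̂(σ) = b^{1/2} Φ̂(s')` with
`s' = 1/2 + b(σ - 1/2 - it)`, a point at HORIZONTAL distance `b|σ - 1/2| ≤ b/2` and vertical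
distance `b|t|` from `1/2`.  One integration by parts (`weilMellin_deriv`) and the window bound
`∫ |Φ'| e^{A|x|} ≤ e^{Aa} ‖Φ'‖₁` (`supp Φ ⊆ [-a, a]`) give

  `‖Φ̂(s)‖ · ‖s - 1/2‖ ≤ e^{|Re s - 1/2| a} ‖Φ'‖₁`   (`norm_weilMellin_mul_norm_sub_half_le`),

hence `‖f̂(σ)‖ ≤ e^{ab/2} ‖Φ'‖₁ / |t|` for `σ ∈ [0, 1]`, `b ≥ 1`, `t ≠ 0`
(`norm_weilMellin_probe_real_le`) and

  `|Re (polar term of f ⋆ f̃)| ≤ 2 e^{ab} ‖Φ'‖₁² / t²`   (`abs_re_weilPolarTerm_probe_le`).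

On a window at height `h ≥ e^{2b}` this is `O_Φ(1)`: the polar part of (U) in Lemma 2k.E of the
soloist's `paper/sharpest.md` §2k (xi).
-/

noncomputable section

open Real Complex MeasureTheory Set Filter Literature.NumberTheory.LFunctions

namespace Summit.RiemannHypothesis.RiemannHypothesis.Theorems

/-- One integration by parts with the window weight: for a Weil test `Φ` supported in
`[-a, a]` and every `s`, `‖Φ̂(s)‖ ‖s - 1/2‖ ≤ e^{|Re s - 1/2| a} ∫ |Φ'|`. -/
theorem norm_weilMellin_mul_norm_sub_half_le {Φ : ℝ → ℂ} (hΦ : IsWeilTest Φ) {a : ℝ}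
    (ha : tsupport Φ ⊆ Icc (-a) a) (s : ℂ) :
    ‖weilMellin Φ s‖ * ‖s - 1 / 2‖ ≤ Real.exp (|s.re - 1 / 2| * a) * ∫ x : ℝ, ‖deriv Φ x‖ := by
  have h1 : ‖weilMellin Φ s‖ * ‖s - 1 / 2‖ = ‖weilMellin (deriv Φ) s‖ := by
    rw [weilMellin_deriv hΦ, norm_mul, norm_neg, mul_comm]
  rw [h1]
  exact (norm_weilMellin_le_weilL1W hΦ.deriv.1.continuous hΦ.deriv.2 le_rfl).trans
    (weilL1W_le_exp_mul_integral_norm hΦ.deriv.1.continuous hΦ.deriv.2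
      (tsupport_deriv_subset.trans ha) (abs_nonneg _))

/-- **The probe's Mellin transform at real points of `[0, 1]`**: for `b ≥ 1`, `t ≠ 0`,
`|σ - 1/2| ≤ 1/2`: `‖f̂(σ)‖ ≤ e^{ab/2} ‖Φ'‖₁ / |t|`. -/
theorem norm_weilMellin_probe_real_le {Φ : ℝ → ℂ} (hΦ : IsWeilTest Φ) {a : ℝ} (ha0 : 0 ≤ a)
    (ha : tsupport Φ ⊆ Icc (-a) a) {b : ℝ} (hb : 1 ≤ b) {t : ℝ} (ht : t ≠ 0) {σ : ℝ}
    (hσ : |σ - 1 / 2| ≤ 1 / 2) :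
    ‖weilMellin (fun x ↦ weilDilate (b⁻¹ - 1) Φ x * cexp (((-t) * x : ℝ) * I)) (σ : ℂ)‖ ≤
      Real.exp (a * b / 2) * (∫ x : ℝ, ‖deriv Φ x‖) / |t| := by
  have hb0 : 0 < b := by linarith
  obtain ⟨w, hw⟩ : ∃ w : ℂ, w = (σ : ℂ) - 1 / 2 - (t : ℂ) * I := ⟨_, rfl⟩
  have hw' : w = ((σ - 1 / 2 : ℝ) : ℂ) + ((-t : ℝ) : ℂ) * I := by rw [hw]; push_cast; ring
  have hwre : w.re = σ - 1 / 2 := by rw [hw']; simp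
  have hwim : w.im = -t := by rw [hw']; simp
  obtain ⟨s, hs⟩ : ∃ s : ℂ, s = 1 / 2 + (b : ℂ) * w := ⟨_, rfl⟩
  have hs1 : s - 1 / 2 = (b : ℂ) * w := by rw [hs]; ring
  have hsre : s.re - 1 / 2 = b * (σ - 1 / 2) := by
    rw [← hwre, ← Complex.re_ofReal_mul, ← hs1, Complex.sub_re]
    norm_num
  have hnorm : b * |t| ≤ ‖s - 1 / 2‖ := by
    rw [hs1, norm_mul, Complex.norm_real, Real.norm_of_nonneg hb0.le]
    refine mul_le_mul_of_nonneg_left ?_ hb0.le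
    have h := Complex.abs_im_le_norm w
    rwa [hwim, abs_neg] at h
  have hA : |s.re - 1 / 2| * a ≤ a * b / 2 := by
    rw [hsre, abs_mul, abs_of_pos hb0]
    have := mul_le_mul_of_nonneg_left hσ (mul_nonneg hb0.le ha0)
    linarith
  have hP := norm_weilMellin_mul_norm_sub_half_le hΦ ha s
  have hD : 0 ≤ ∫ x : ℝ, ‖deriv Φ x‖ := integral_nonneg fun _ ↦ norm_nonneg _
  have hP' : ‖weilMellin Φ s‖ * ‖s - 1 / 2‖ ≤ Real.exp (a * b / 2) * ∫ x : ℝ, ‖deriv Φ x‖ :=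
    hP.trans (mul_le_mul_of_nonneg_right (Real.exp_le_exp.2 hA) hD)
  have hsq : Real.sqrt b⁻¹ ≤ 1 := Real.sqrt_le_one.mpr (inv_le_one_of_one_le₀ hb)
  rw [weilMellin_probe Φ hb0 t, ← hw, ← hs, norm_mul, norm_mul, Complex.norm_real,
    Complex.norm_real, Real.norm_of_nonneg (Real.sqrt_nonneg _), Real.norm_of_nonneg hb0.le,
    le_div_iff₀ (abs_pos.2 ht)]
  calc Real.sqrt b⁻¹ * b * ‖weilMellin Φ s‖ * |t|
      = Real.sqrt b⁻¹ * (‖weilMellin Φ s‖ * (b * |t|)) := by ring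
    _ ≤ 1 * (‖weilMellin Φ s‖ * ‖s - 1 / 2‖) :=
        mul_le_mul hsq (mul_le_mul_of_nonneg_left hnorm (norm_nonneg _)) (by positivity)
          zero_le_one
    _ ≤ Real.exp (a * b / 2) * ∫ x : ℝ, ‖deriv Φ x‖ := by rw [one_mul]; exact hP'

/-- **Polar term of the probe** (step R2c' of Lemma 2k.E): for `b ≥ 1` and `t ≠ 0`,
`|Re (polar term of f ⋆ f̃)| ≤ 2 (e^{ab/2} ‖Φ'‖₁ / |t|)²`. -/
theorem abs_re_weilPolarTerm_probe_le {Φ : ℝ → ℂ} (hΦ : IsWeilTest Φ) {a : ℝ} (ha0 : 0 ≤ a)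
    (ha : tsupport Φ ⊆ Icc (-a) a) {b : ℝ} (hb : 1 ≤ b) {t : ℝ} (ht : t ≠ 0) :
    |(weilPolarTerm (weilConv (fun x ↦ weilDilate (b⁻¹ - 1) Φ x * cexp (((-t) * x : ℝ) * I))
        (weilReflect fun x ↦ weilDilate (b⁻¹ - 1) Φ x * cexp (((-t) * x : ℝ) * I)))).re| ≤
      2 * (Real.exp (a * b / 2) * (∫ x : ℝ, ‖deriv Φ x‖) / |t|) ^ 2 := by
  have hb0 : 0 < b := by linarith
  rw [weilPolarTerm_weilConv_weilReflect (isWeilTest_probe hΦ hb0 t), Complex.ofReal_re]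
  have h0 := norm_weilMellin_probe_real_le hΦ ha0 ha hb ht (σ := 0) (by norm_num)
  have h1 := norm_weilMellin_probe_real_le hΦ ha0 ha hb ht (σ := 1) (by norm_num)
  rw [Complex.ofReal_zero] at h0
  rw [Complex.ofReal_one] at h1
  have hM : 0 ≤ Real.exp (a * b / 2) * (∫ x : ℝ, ‖deriv Φ x‖) / |t| := by positivity
  have hz := Complex.abs_re_le_norm
    (weilMellin (fun x ↦ weilDilate (b⁻¹ - 1) Φ x * cexp (((-t) * x : ℝ) * I)) 0 *
      (starRingEnd ℂ) (weilMellin (fun x ↦ weilDilate (b⁻¹ - 1) Φ x *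
        cexp (((-t) * x : ℝ) * I)) 1))
  rw [norm_mul, Complex.norm_conj] at hz
  rw [abs_mul, abs_two]
  have hprod := mul_le_mul h0 h1 (norm_nonneg _) hM
  nlinarith

end Summit.RiemannHypothesis.RiemannHypothesis.Theorems

end
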